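import Summits.Ventures.PercRepro.PuncturedLYMTwoCoHypWeights

/-!
# PercRepro — TWO DISJOINT CO-HYPERPLANES, PART 6b: THE COLUMN IDENTITIES OF THE EXPLICIT FLOW (p10, gen 35)

Arithmetic only, continuing part 6.  For the weights `wA`, `wB`, `wR` of PuncturedLYMTwoCoHypWeights:
* `col_layer1` — the untouched column `(m₁ − 1, b')` sums to `twoK`: the `+B` correction of the row `(m₁ − 1, b' − 1)`
  and the `+R` correction of the row `(m₁ − 1, b')` cancel edge for edge;
* `col_corner_corr` — the corner column `(m₁ − 1, m₂ − 1)` (`m₁ + m₂ = j + 2`): the two layer corrections below it and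
  the corner `+R` weight cancel — the "corner identity" of proofs/P10-BOUNDARY-g34.md §2′, proved from the top, row and
  column identities of the two one-co-hyperplane flows;
* **`w_col`** — every realisable untouched column sums to `twoK`;
* **`w_top₁`** / **`w_top₂`** — every touched column sums to `twoK`
— the remaining identity hypotheses of `puncturedNMP_two_of_seq`.  Positivity is part 7.  Nothing here asserts (SP).
-/

namespace PercRepro.PuncturedLYM

open Finset

/-! ### The column identities -/

/-- **The untouched column `(m₁ − 1, b')`** (`b' + 1 < m₂`, `m₁ + b' ≤ j + 2`) sums to `twoK`: it receives `+A` from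
the interior row `(m₁ − 2, b')`, `+B` from the layer-1 row `(m₁ − 1, b' − 1)` and `+R` from the layer-1 row
`(m₁ − 1, b')`, and the two corrections cancel. -/
theorem col_layer1 {n j m₁ m₂ b' : ℕ} (hm₁ : 2 ≤ m₁) (hm₁j : m₁ ≤ j) (hm₂ : 2 ≤ m₂) (hm₂j : m₂ ≤ j)
    (hn : 2 * j + 1 ≤ n) (hb : b' + 1 < m₂) (hbL : m₁ + b' ≤ j + 2) :
    ((m₁ - 1 : ℕ) : ℚ) * wA n j m₁ m₂ (m₁ - 1 - 1) b' + (b' : ℚ) * wB n j m₁ m₂ (m₁ - 1) (b' - 1) +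
      ((j : ℚ) + 1 - ((m₁ - 1 : ℕ) : ℚ) - b') * wR n j m₁ m₂ (m₁ - 1) b' = twoK n j m₁ m₂ := by
  have hcol := sup_col (by omega) hm₁j (by omega) hm₂j hn (a' := m₁ - 1) (b' := b') (by omega) (by omega)
  unfold wA wB wR
  split_ifs <;> try omega
  have hcorr : (b' : ℚ) * cBeta n j m₁ m₂ (b' - 1) + ((j : ℚ) + 1 - ((m₁ - 1 : ℕ) : ℚ) - b') * cGamma n j m₁ m₂ b' = 0 := by
    rcases Nat.eq_zero_or_pos b' with h0 | hpos
    · subst h0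
      unfold cGamma
      simp
    · unfold cBeta cGamma
      have e1 : ((j + 1 - m₁ - (b' - 1) : ℕ) : ℚ) = (j : ℚ) + 1 - ((m₁ - 1 : ℕ) : ℚ) - b' := by
        rw [Nat.cast_sub (by omega), Nat.cast_sub (by omega), Nat.cast_sub (by omega), Nat.cast_sub (by omega)]
        push_cast
        ring
      have e2 : ((m₂ - (b' - 1) : ℕ) : ℚ) = ((m₂ + 1 - b' : ℕ) : ℚ) := by
        congr 1
        omega
      rw [e1, e2]
      ring
  linear_combination hcol + hcorr

/-- **The corner column `(m₁ − 1, m₂ − 1)`** when `m₁ + m₂ = j + 2`: the two `+B`/`+A` corrections of the layer rows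
below it and the corner `+R` weight cancel (the "corner identity" of proofs/P10-BOUNDARY-g34.md §2′). -/
theorem col_corner_corr {n j m₁ m₂ : ℕ} (hm₁ : 2 ≤ m₁) (hm₁j : m₁ ≤ j) (hm₂ : 2 ≤ m₂) (hm₂j : m₂ ≤ j)
    (hsum : m₁ + m₂ = j + 2) (hn : 2 * j + 1 ≤ n) :
    ((m₁ - 1 : ℕ) : ℚ) * cBeta n j m₂ m₁ (m₁ - 2) + ((m₂ - 1 : ℕ) : ℚ) * cBeta n j m₁ m₂ (m₂ - 2) +
      (cornerR n j m₁ m₂ - supR n j m₁ m₂ (m₁ - 1) (m₂ - 1)) = 0 := by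
  have hr : (0 : ℚ) < ((n - j : ℕ) : ℚ) := by
    have : 1 ≤ n - j := by omega
    exact_mod_cast this
  have hrq : ((n - j : ℕ) : ℚ) = (n : ℚ) - j := by rw [Nat.cast_sub (by omega)]
  have hρ : ((n - m₁ - m₂ : ℕ) : ℚ) = (n : ℚ) - j - 2 := by
    rw [show n - m₁ - m₂ = n - (m₁ + m₂) by omega, Nat.cast_sub (by omega)]
    push_cast
    have : (m₁ : ℚ) + m₂ = (j : ℚ) + 2 := by exact_mod_cast hsum
    linarith
  have hj2 : (2 : ℚ) ≤ j := by exact_mod_cast (show 2 ≤ j by omega)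
  have hn' : (2 : ℚ) * j + 1 ≤ n := by exact_mod_cast hn
  have hm₁q : (2 : ℚ) ≤ m₁ := by exact_mod_cast hm₁
  have hm₂q : (2 : ℚ) ≤ m₂ := by exact_mod_cast hm₂
  have hsumq : (m₁ : ℚ) + m₂ = (j : ℚ) + 2 := by exact_mod_cast hsum
  -- the identities of the two flows
  have ht1 := coF_top (m := m₁) (by omega) hm₁j hn
  have ht2 := coF_top (m := m₂) (by omega) hm₂j hn
  have hr1 := coF_row (m := m₁) (by omega) hm₁j hn (c := m₁ - 1) (by omega)
  have hr2 := coF_row (m := m₂) (by omega) hm₂j hn (c := m₂ - 1) (by omega)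
  have hr1' := coF_row (m := m₁) (by omega) hm₁j hn (c := m₁ - 2) (by omega)
  have hr2' := coF_row (m := m₂) (by omega) hm₂j hn (c := m₂ - 2) (by omega)
  have hc1 := coF_col (m := m₁) (by omega) hm₁j hn (c' := m₁ - 1) (by omega) (by omega)
  have hc2 := coF_col (m := m₂) (by omega) hm₂j hn (c' := m₂ - 1) (by omega) (by omega)
  have hK := twoK_mul_r (m₁ := m₁) (m₂ := m₂) hn
  -- casts
  have c1 : ((m₁ - 1 : ℕ) : ℚ) = (m₁ : ℚ) - 1 := by rw [Nat.cast_sub (by omega)]; push_cast; ring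
  have c2 : ((m₂ - 1 : ℕ) : ℚ) = (m₂ : ℚ) - 1 := by rw [Nat.cast_sub (by omega)]; push_cast; ring
  have c3 : ((m₁ - 2 : ℕ) : ℚ) = (m₁ : ℚ) - 2 := by rw [Nat.cast_sub (by omega)]; push_cast; ring
  have c4 : ((m₂ - 2 : ℕ) : ℚ) = (m₂ : ℚ) - 2 := by rw [Nat.cast_sub (by omega)]; push_cast; ring
  have c5 : m₁ - 1 - 1 = m₁ - 2 := by omega
  have c6 : m₂ - 1 - 1 = m₂ - 2 := by omega
  rw [c5] at hc1
  rw [c6] at hc2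
  rw [c1] at hr1 hc1
  rw [c3] at hr1'
  rw [c2] at hr2 hc2
  rw [c4] at hr2'
  have e1 : ((j + 1 - m₂ - (m₁ - 2) : ℕ) : ℚ) = 1 := by
    rw [show j + 1 - m₂ - (m₁ - 2) = 1 by omega]
    push_cast
    ring
  have e2 : ((j + 1 - m₁ - (m₂ - 2) : ℕ) : ℚ) = 1 := by
    rw [show j + 1 - m₁ - (m₂ - 2) = 1 by omega]
    push_cast
    ring
  have e3 : ((m₁ - (m₁ - 2) : ℕ) : ℚ) = 2 := by
    rw [show m₁ - (m₁ - 2) = 2 by omega]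
    push_cast
    ring
  have e4 : ((m₂ - (m₂ - 2) : ℕ) : ℚ) = 2 := by
    rw [show m₂ - (m₂ - 2) = 2 by omega]
    push_cast
    ring
  -- solve the deficits of the rows below the corner
  have hr2pos : (n : ℚ) - j - 2 ≠ 0 := by linarith
  have hr1pos : (n : ℚ) - j - 1 ≠ 0 := by linarith
  have hm1pos : (m₁ : ℚ) - 1 ≠ 0 := by linarith
  have hm2pos : (m₂ : ℚ) - 1 ≠ 0 := by linarith
  have hm1q : (m₁ : ℚ) ≠ 0 := by linarith
  have hm2q : (m₂ : ℚ) ≠ 0 := by linarith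
  have ef1 : coF n j m₁ (m₁ - 2) =
      2 * (((j : ℚ) + 1 - ((m₁ : ℚ) - 1)) * coF n j m₁ (m₁ - 1) - ((j : ℚ) + 1) * coDel n j m₁) /
        (((n : ℚ) - j - 2) * ((m₁ : ℚ) - 1)) := by
    rw [eq_div_iff (mul_ne_zero hr2pos hm1pos)]
    have : ((m₁ : ℚ) - ((m₁ : ℚ) - 2)) = 2 := by ring
    rw [this] at hr1'
    have : ((n : ℚ) - j - m₁ + ((m₁ : ℚ) - 2)) = (n : ℚ) - j - 2 := by ring
    rw [this] at hr1'
    linear_combination (-((m₁ : ℚ) - 1)) * hr1' + 2 * hc1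
  have ef2 : coF n j m₂ (m₂ - 2) =
      2 * (((j : ℚ) + 1 - ((m₂ : ℚ) - 1)) * coF n j m₂ (m₂ - 1) - ((j : ℚ) + 1) * coDel n j m₂) /
        (((n : ℚ) - j - 2) * ((m₂ : ℚ) - 1)) := by
    rw [eq_div_iff (mul_ne_zero hr2pos hm2pos)]
    have : ((m₂ : ℚ) - ((m₂ : ℚ) - 2)) = 2 := by ring
    rw [this] at hr2'
    have : ((n : ℚ) - j - m₂ + ((m₂ : ℚ) - 2)) = (n : ℚ) - j - 2 := by ring
    rw [this] at hr2'
    linear_combination (-((m₂ : ℚ) - 1)) * hr2' + 2 * hc2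
  have ef1' : coF n j m₁ (m₁ - 1) = (((j : ℚ) + 1) * (1 - coDel n j m₁) / (m₁ : ℚ) - 1) / ((n : ℚ) - j - 1) := by
    rw [eq_div_iff hr1pos]
    have : ((m₁ : ℚ) - ((m₁ : ℚ) - 1)) = 1 := by ring
    rw [this] at hr1
    have : ((n : ℚ) - j - m₁ + ((m₁ : ℚ) - 1)) = (n : ℚ) - j - 1 := by ring
    rw [this, one_mul] at hr1
    field_simp
    linear_combination (-(m₁ : ℚ)) * hr1 + ht1
  have ef2' : coF n j m₂ (m₂ - 1) = (((j : ℚ) + 1) * (1 - coDel n j m₂) / (m₂ : ℚ) - 1) / ((n : ℚ) - j - 1) := by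
    rw [eq_div_iff hr1pos]
    have : ((m₂ : ℚ) - ((m₂ : ℚ) - 1)) = 1 := by ring
    rw [this] at hr2
    have : ((n : ℚ) - j - m₂ + ((m₂ : ℚ) - 1)) = (n : ℚ) - j - 1 := by ring
    rw [this, one_mul] at hr2
    field_simp
    linear_combination (-(m₂ : ℚ)) * hr2 + ht2
  have hnj : (n : ℚ) - j ≠ 0 := by linarith
  have hxv1 : coXv n j m₁ (m₁ - 1) = (1 - coF n j m₁ (m₁ - 1)) / ((n : ℚ) - j) := by
    rw [eq_div_iff hnj]
    unfold coF
    rw [hrq]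
    ring
  have hxv2 : coXv n j m₂ (m₂ - 1) = (1 - coF n j m₂ (m₂ - 1)) / ((n : ℚ) - j) := by
    rw [eq_div_iff hnj]
    unfold coF
    rw [hrq]
    ring
  have hK' : twoK n j m₁ m₂ = ((j : ℚ) + 1) * (1 - coDel n j m₁ - coDel n j m₂) / ((n : ℚ) - j) := by
    rw [eq_div_iff (by linarith)]
    rw [hrq] at hK
    linear_combination hK
  unfold cBeta cornerR supR
  rw [e1, e2, e3, e4, hρ, hxv1, hxv2, hK', ef1, ef2, ef1', ef2', c1, c2, hrq]
  field_simp
  linear_combination (-2 + coDel n j m₂ + coDel n j m₁ + (m₂ : ℚ) + m₁ - 2 * (j : ℚ) + (j : ℚ) * coDel n j m₂ +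
    (j : ℚ) * coDel n j m₁) * hsumq

/-- **THE COLUMN IDENTITY**: every realisable untouched column `(a', b')` (`a' < m₁`, `b' < m₂`,
`a' + b' ≤ j + 1 ≤ a' + b' + (n − m₁ − m₂)`) sums to `twoK`. -/
theorem w_col {n j m₁ m₂ : ℕ} (hm₁ : 2 ≤ m₁) (hm₁j : m₁ ≤ j) (hm₂ : 2 ≤ m₂) (hm₂j : m₂ ≤ j)
    (hbig : j + 2 ≤ m₁ + m₂) (hn : 2 * j + 1 ≤ n) (a' b' : ℕ) (ha : a' < m₁) (hb : b' < m₂)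
    (hab : a' + b' ≤ j + 1) :
    (a' : ℚ) * wA n j m₁ m₂ (a' - 1) b' + (b' : ℚ) * wB n j m₁ m₂ a' (b' - 1) +
      ((j : ℚ) + 1 - a' - b') * wR n j m₁ m₂ a' b' = twoK n j m₁ m₂ := by
  by_cases h1 : a' + 1 = m₁
  · by_cases h2 : b' + 1 = m₂
    · -- the corner column: `m₁ + m₂ ∈ {j + 2, j + 3}`
      obtain rfl : a' = m₁ - 1 := by omega
      obtain rfl : b' = m₂ - 1 := by omega
      have hcol := sup_col (by omega) hm₁j (by omega) hm₂j hn (a' := m₁ - 1) (b' := m₂ - 1) (by omega) (by omega)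
      unfold wA wB wR
      split_ifs <;> try omega
      rcases Nat.eq_or_lt_of_le hbig with hsum | hsum
      · -- `m₁ + m₂ = j + 2`: the coefficient of the corner `+R` is `1`
        have hcorner := col_corner_corr hm₁ hm₁j hm₂ hm₂j hsum.symm hn
        have ec : (j : ℚ) + 1 - ((m₁ - 1 : ℕ) : ℚ) - ((m₂ - 1 : ℕ) : ℚ) = 1 := by
          rw [Nat.cast_sub (by omega), Nat.cast_sub (by omega)]
          push_cast
          have : (m₁ : ℚ) + m₂ = (j : ℚ) + 2 := by exact_mod_cast hsum.symm
          linarith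
        rw [ec] at hcol ⊢
        have c5 : m₁ - 1 - 1 = m₁ - 2 := by omega
        have c6 : m₂ - 1 - 1 = m₂ - 2 := by omega
        rw [c5, c6] at hcol ⊢
        linear_combination hcol + hcorner
      · -- `m₁ + m₂ = j + 3`: the coefficient is `0` and both corrections vanish
        have hsum3 : m₁ + m₂ = j + 3 := by omega
        have ec : (j : ℚ) + 1 - ((m₁ - 1 : ℕ) : ℚ) - ((m₂ - 1 : ℕ) : ℚ) = 0 := by
          rw [Nat.cast_sub (by omega), Nat.cast_sub (by omega)]
          push_cast
          have : (m₁ : ℚ) + m₂ = (j : ℚ) + 3 := by exact_mod_cast hsum3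
          linarith
        rw [ec] at hcol ⊢
        have hβ1 : cBeta n j m₂ m₁ (m₁ - 1 - 1) = 0 := by
          unfold cBeta
          rw [show j + 1 - m₂ - (m₁ - 1 - 1) = 0 by omega]
          simp
        have hβ2 : cBeta n j m₁ m₂ (m₂ - 1 - 1) = 0 := by
          unfold cBeta
          rw [show j + 1 - m₁ - (m₂ - 1 - 1) = 0 by omega]
          simp
        rw [hβ1, hβ2]
        linear_combination hcol
    · -- layer 1
      obtain rfl : a' = m₁ - 1 := by omega
      exact col_layer1 hm₁ hm₁j hm₂ hm₂j hn (by omega) (by omega)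
  · by_cases h2 : b' + 1 = m₂
    · -- layer 2: the mirror image
      obtain rfl : b' = m₂ - 1 := by omega
      have h := col_layer1 (n := n) (j := j) (m₁ := m₂) (m₂ := m₁) (b' := a') hm₂ hm₂j hm₁ hm₁j hn (by omega)
        (by omega)
      rw [wA_symm n j m₁ m₂ (a' - 1) (m₂ - 1), wB_symm n j m₁ m₂ a' (m₂ - 1 - 1), wR_symm n j m₁ m₂ a' (m₂ - 1),
        twoK_symm]
      linear_combination h
    · -- the interior
      have hcol := sup_col (by omega) hm₁j (by omega) hm₂j hn ha hb
      unfold wA wB wR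
      split_ifs <;> first | exact hcol | (exfalso; omega)

/-- **The touched columns of `C₁`**: `m₁·wA (m₁ − 1) b' = twoK`. -/
theorem w_top₁ {n j m₁ m₂ : ℕ} (hm₁ : 1 ≤ m₁) (b' : ℕ) :
    (m₁ : ℚ) * wA n j m₁ m₂ (m₁ - 1) b' = twoK n j m₁ m₂ := by
  unfold wA
  rw [if_pos (by omega)]
  have : (m₁ : ℚ) ≠ 0 := by
    have : (1 : ℚ) ≤ m₁ := by exact_mod_cast hm₁
    linarith
  field_simp

/-- **The touched columns of `C₂`**: `m₂·wB a' (m₂ − 1) = twoK`. -/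
theorem w_top₂ {n j m₁ m₂ : ℕ} (hm₂ : 1 ≤ m₂) (a' : ℕ) :
    (m₂ : ℚ) * wB n j m₁ m₂ a' (m₂ - 1) = twoK n j m₁ m₂ := by
  unfold wB
  rw [if_pos (by omega)]
  have : (m₂ : ℚ) ≠ 0 := by
    have : (1 : ℚ) ≤ m₂ := by exact_mod_cast hm₂
    linarith
  field_simp

end PercRepro.PuncturedLYM
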